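import Literature.NumberTheory.Sieve.ChenTheorem
import Literature.NumberTheory.Sieve.JurkatRichertRefutation
import HarnessLib

/-!
# Chen's theorem: the Mertens estimate for `V(z)` (Nathanson, Thm 10.3, corrected) — PROVED

Topic `Literature/NumberTheory/Sieve`; companion of `ChenTheorem.lean`, which vendors the
architecture of the printed proof of Chen's theorem `N = p + P₂` (Nathanson, *Additive Number
Theory: The Classical Bases*, GTM 164, Ch. 10) as named facts. This file DISCHARGES one of them,
`Literature.NumberTheory.Sieve.Chen.chen_sieveProduct_estimate` (Thm 10.3 in its corrected form):
for even `N → ∞` and `z = N^{1/8}`,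

  `V(z) = ∏_{p < z, p ∤ N} (1 - 1/(p-1)) = 2 𝔖(N) e^{-γ}/log z · (1 + O(1/log N))`,

`𝔖(N) = C₂ ∏_{p ∣ N, p > 2} (p-1)/(p-2)`, `C₂ = ∏_{p > 2} (1 - 1/(p-1)²)`, with the explicit constants
`C = 936`, `N ≥ N₀ ⇔ log N ≥ 400` (`chen_sieveProduct_estimate_holds`). Everything here is proved.

## Source check

Nathanson, Thm 10.3 (p. 170 of the held copy) prints `V(z) = 𝔖(N) e^{-γ}/log z (1 + O(1/log N))`;
the proof (pp. 170–171) computes `W(z) ∏_{p<z} (1 - 1/p)⁻¹ = 2 ∏_{2<p<z} (1 - 1/(p-1)²)`,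
`W(z) = ∏_{2<p<z} (1 - 1/(p-1))`, and loses the factor `2 = (1 - 1/2)⁻¹` in the last display. The
vendored fact carries the factor `2` (see its docstring in `ChenTheorem.lean`); the theorem below
confirms that the corrected statement is the true one (for `N = 2^k`, `V(z) log z e^γ → 2 C₂`).

## Proof (Nathanson pp. 170–171, with a sharper count of the large prime factors)

Write `Z = ⌈z⌉`, `U = ∏_{p<z} (1 - 1/p)`, `T = ∏_{2<p<z} (1 - 1/(p-1)²)` (`= twinPrimeConstPartial (Z-1)`),
`Q_z = ∏_{p ∣ N, 2<p<z} (p-1)/(p-2)`, `R = ∏_{p ∣ N, p ≥ z} (p-1)/(p-2)`, `L = log z = (log N)/8`.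
* `sieveProduct_eq_mul`: `V(z) = 2 U T Q_z` for even `N ≠ 0`, `z > 2` (the book's
  `V = (V/W) W`, `W ∏_{p<z}(1-1/p)⁻¹ = 2 ∏_{2<p<z}(1 - 1/(p-1)²)`: for `p > 2`,
  `(1 - 1/p)(1 - 1/(p-1)²) = 1 - 1/(p-1)` and `(1 - 1/(p-1)) (p-1)/(p-2) = 1`);
  and `𝔖(N) = C₂ Q_z R`.
* `abs_mertensFactor_sub_one_le`: `|U e^γ L - 1| ≤ 50/L` for `L ≥ 25` — Mertens' product theorem
  with rate for a real cut-off, `Literature.NumberTheory.Sieve.PairProducts.abs_log_mertensProd_sub_le`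
  (`|log ∏_{p<z}(1-1/p)⁻¹ - log log z - γ| ≤ 25/log z`, from Hardy–Wright Thm 429), and
  `|e^{-E} - 1| ≤ 2|E|`.
* `twinPrimeConstPartial_mul_le_twinPrimeConst`: the tail of `C₂`,
  `C₂ ≤ ∏_{2<p≤x} (1 - 1/(p-1)²) ≤ C₂ x/(x-1)` (`x ≥ 2`): the primes of `(x, y]` are among the
  integers of `(x, y]`, over which the product telescopes, `∏_{x<n≤y} (1 - 1/(n-1)²) =
  (x-1)/x · y/(y-1) ≥ (x-1)/x` (`prod_Ioc_twinPrimeConstFactor`), and `C₂ = lim_y` of the partial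
  products (`Literature.NumberTheory.Sieve.tendsto_twinPrimeConstPartial_holds`). Hence
  `1 ≤ T/C₂ ≤ 1 + 1/(Z-2) ≤ 1 + 1/L` (the book: `∏_{p≥z}(1 + 1/(p(p-2))) < 1 + 2/z`).
* `card_le_eight_of_prod_dvd`: `N ≤ z⁸` has at most `8` prime factors `p ≥ z` (their product divides
  `N`), so `1 ≤ R ≤ (1 + 1/(z-2))⁸ ≤ e^{8/(z-2)} ≤ 1 + 16/L` (the book bounds instead
  `∏_{p≥z, p∣N} (1 - 1/(p-1)) > 1 - 8 log N/N^{1/8}` via `ω(N) < log N`, to the same effect).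
* Bookkeeping (`abs_sub_le_of_relErrors`): `V R = M α β` with `M = 2 𝔖(N) e^{-γ}/L`, `α = U e^γ L`,
  `β = T/C₂`, so `|V - M| = M |αβ - R|/R ≤ M (2|α-1| + (β-1) + (R-1)) ≤ 117 M/L = 936 M/log N`.

## References

* M. B. Nathanson, *Additive Number Theory: The Classical Bases*, GTM 164, Springer (1996),
  Thm 10.3, pp. 170–171 of the held copy; Thm 6.8 (Mertens's formula). [Nathanson1996]
* G. H. Hardy, E. M. Wright, *An Introduction to the Theory of Numbers*, Thm 429. [HardyWright2008]
-/

noncomputable section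

open Finset Filter
open scoped Topology

namespace Literature.NumberTheory.Sieve.Chen

/-! ### The tail of the twin prime constant -/

/-- Telescoping over a block of consecutive integers:
`∏_{x < n ≤ y} (1 - 1/(n-1)²) = (x-1)/x · y/(y-1)` for `2 ≤ x ≤ y`
(`1 - 1/(n-1)² = (n-2)n/(n-1)²`). [folklore] -/
theorem prod_Ioc_twinPrimeConstFactor {x y : ℕ} (hx : 2 ≤ x) (hxy : x ≤ y) :
    ∏ n ∈ Ioc x y, (1 - 1 / ((n : ℝ) - 1) ^ 2) = ((x : ℝ) - 1) / x * (y / ((y : ℝ) - 1)) := by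
  have hx2 : (2 : ℝ) ≤ x := by exact_mod_cast hx
  have hx0 : (x : ℝ) ≠ 0 := by positivity
  have hx1 : (x : ℝ) - 1 ≠ 0 := (by linarith : (0 : ℝ) < x - 1).ne'
  induction y, hxy using Nat.le_induction with
  | base =>
    rw [Finset.Ioc_self, Finset.prod_empty]
    field_simp
  | succ y hxy ih =>
    rw [Finset.prod_Ioc_succ_top hxy, ih]
    have hy2 : (2 : ℝ) ≤ y := by exact_mod_cast hx.trans hxy
    have hy0 : (y : ℝ) ≠ 0 := by positivity
    have hy1 : (y : ℝ) - 1 ≠ 0 := (by linarith : (0 : ℝ) < y - 1).ne'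
    have hcast : ((y + 1 : ℕ) : ℝ) - 1 = y := by push_cast; ring
    rw [hcast]
    push_cast
    field_simp
    ring

/-- For `2 ≤ x ≤ y`: `∏_{2<p≤x} (1 - 1/(p-1)²) · (x-1)/x ≤ ∏_{2<p≤y} (1 - 1/(p-1)²)` — the new prime
factors `x < p ≤ y` form a subset of the integers `x < n ≤ y`, all factors lie in `[0, 1]`, and over
the integers the product telescopes to `(x-1)/x · y/(y-1) ≥ (x-1)/x`. [folklore] -/
theorem twinPrimeConstPartial_mul_le {x y : ℕ} (hx : 2 ≤ x) (hxy : x ≤ y) :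
    twinPrimeConstPartial x * (((x : ℝ) - 1) / x) ≤ twinPrimeConstPartial y := by
  have hx2 : (2 : ℝ) ≤ x := by exact_mod_cast hx
  have hy2 : (2 : ℝ) ≤ y := by exact_mod_cast hx.trans hxy
  -- split the partial product at `x`
  have hsplit : twinPrimeConstPartial y = twinPrimeConstPartial x *
      ∏ p ∈ ((Nat.primesLE y).filter (2 < ·)).filter (fun p : ℕ => ¬p ≤ x),
        (1 - 1 / ((p : ℝ) - 1) ^ 2) := by
    unfold twinPrimeConstPartial
    rw [← Finset.prod_filter_mul_prod_filter_not ((Nat.primesLE y).filter (2 < ·))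
      (fun p : ℕ => p ≤ x)]
    congr 2
    ext p
    simp only [Finset.mem_filter, Nat.mem_primesLE]
    constructor
    · rintro ⟨⟨⟨-, hp⟩, h2⟩, hpx⟩
      exact ⟨⟨hpx, hp⟩, h2⟩
    · rintro ⟨⟨hpx, hp⟩, h2⟩
      exact ⟨⟨⟨hpx.trans hxy, hp⟩, h2⟩, hpx⟩
  rw [hsplit]
  have h0 : 0 ≤ twinPrimeConstPartial x :=
    le_trans (by norm_num) (half_le_twinPrimeConstPartial x)
  refine mul_le_mul_of_nonneg_left ?_ h0
  have hfrac : 0 ≤ ((x : ℝ) - 1) / x := div_nonneg (by linarith) (by linarith)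
  calc ((x : ℝ) - 1) / x ≤ ((x : ℝ) - 1) / x * (y / ((y : ℝ) - 1)) := by
        refine le_mul_of_one_le_right hfrac ?_
        rw [le_div_iff₀ (by linarith)]
        linarith
    _ = ∏ n ∈ Ioc x y, (1 - 1 / ((n : ℝ) - 1) ^ 2) := (prod_Ioc_twinPrimeConstFactor hx hxy).symm
    _ ≤ _ := by
        apply Finset.prod_le_prod_of_subset_of_le_one
        · intro p hp
          simp only [Finset.mem_filter, Nat.mem_primesLE, not_le] at hp
          simp only [Finset.mem_Ioc]
          exact ⟨hp.2, hp.1.1.1⟩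
        · intro n hn
          simp only [Finset.mem_Ioc] at hn
          exact twinPrimeConstFactor_nonneg (by omega)
        · intro n _ _
          exact twinPrimeConstFactor_le_one n

/-- `C₂ ≤ ∏_{2<p≤x} (1 - 1/(p-1)²)` for every `x` (`C₂` is the infimum of the non-increasing partial
products, `Literature.NumberTheory.Sieve.twinPrimeConst_eq_ciInf`). [folklore] -/
theorem twinPrimeConst_le_twinPrimeConstPartial (x : ℕ) :
    twinPrimeConst ≤ twinPrimeConstPartial x := by
  rw [twinPrimeConst_eq_ciInf]
  exact ciInf_le ⟨1 / 2, by rintro _ ⟨y, rfl⟩; exact half_le_twinPrimeConstPartial y⟩ x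

/-- **Tail of the twin prime constant**: `∏_{2<p≤x} (1 - 1/(p-1)²) · (x-1)/x ≤ C₂` for `x ≥ 2`,
i.e. `C₂ ≤ ∏_{2<p≤x} (1 - 1/(p-1)²) ≤ C₂ (1 + 1/(x-1))` — the `1 + O(1/z)` of Nathanson's proof of
Thm 10.3 (`∏_{p≥z} (1 + 1/(p(p-2))) < 1 + 2/z`), here by telescoping and passage to the limit
`y → ∞` in `twinPrimeConstPartial_mul_le`. [cite: Nathanson1996, Thm 10.3 (proof)] -/
theorem twinPrimeConstPartial_mul_le_twinPrimeConst {x : ℕ} (hx : 2 ≤ x) :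
    twinPrimeConstPartial x * (((x : ℝ) - 1) / x) ≤ twinPrimeConst := by
  have hlim : Tendsto twinPrimeConstPartial atTop (𝓝 twinPrimeConst) :=
    tendsto_twinPrimeConstPartial_holds
  exact ge_of_tendsto hlim (eventually_atTop.mpr ⟨x, fun y hy => twinPrimeConstPartial_mul_le hx hy⟩)

/-! ### Mertens' product theorem for the real cut-off `z` -/

/-- **Mertens with rate, multiplicative form**: for `z ≥ 2` with `log z ≥ 25`,
`|∏_{p<z} (1 - 1/p) · e^γ log z - 1| ≤ 50/log z`
(`Literature.NumberTheory.Sieve.PairProducts.abs_log_mertensProd_sub_le`: `|log ∏_{p<z}(1-1/p)⁻¹ - log log z - γ|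
≤ 25/log z`, and `|e^{-E} - 1| ≤ 2|E|` for `|E| ≤ 1`). [cite: Nathanson1996, Thm 6.8] -/
theorem abs_mertensFactor_sub_one_le {z : ℝ} (hz2 : 2 ≤ z) (hz : 25 ≤ Real.log z) :
    |(∏ p ∈ Nat.primesBelow ⌈z⌉₊, (1 - (p : ℝ)⁻¹)) *
        (Real.exp Real.eulerMascheroniConstant * Real.log z) - 1| ≤ 50 / Real.log z := by
  have hL : 0 < Real.log z := by linarith
  have hPi : 0 < PairProducts.mertensProd z := PairProducts.mertensProd_pos z
  set E := Real.log (PairProducts.mertensProd z) - Real.log (Real.log z) -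
    Real.eulerMascheroniConstant with hE
  have hEle : |E| ≤ 25 / Real.log z := PairProducts.abs_log_mertensProd_sub_le hz2
  have hE1 : |E| ≤ 1 := hEle.trans (by rw [div_le_one hL]; exact hz)
  have hU : ∏ p ∈ Nat.primesBelow ⌈z⌉₊, (1 - (p : ℝ)⁻¹) = (PairProducts.mertensProd z)⁻¹ := by
    rw [PairProducts.mertensProd, Finset.prod_inv_distrib, inv_inv]
  have hPiE : PairProducts.mertensProd z =
      Real.exp E * Real.log z * Real.exp Real.eulerMascheroniConstant := by
    rw [hE, sub_sub, Real.exp_sub, Real.exp_add, Real.exp_log hL, Real.exp_log hPi]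
    field_simp
  have hkey : (PairProducts.mertensProd z)⁻¹ *
      (Real.exp Real.eulerMascheroniConstant * Real.log z) = Real.exp (-E) := by
    rw [hPiE, Real.exp_neg]
    field_simp
  rw [hU, hkey]
  calc |Real.exp (-E) - 1| ≤ 2 * |-E| := Real.abs_exp_sub_one_le (by rwa [abs_neg])
    _ = 2 * |E| := by rw [abs_neg]
    _ ≤ 2 * (25 / Real.log z) := by gcongr
    _ = 50 / Real.log z := by ring

/-! ### The algebraic decomposition of `V(z)` and of `𝔖(N)` -/

/-- **`V(z) = 2 U T Q_z`** for even `N ≠ 0` and `z > 2`: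
`∏_{p<z, p∤N} (1 - 1/(p-1)) = 2 · ∏_{p<z} (1 - 1/p) · ∏_{2<p<z} (1 - 1/(p-1)²) ·
∏_{p∣N, 2<p<z} (p-1)/(p-2)` (Nathanson pp. 170–171: `V = (V/W) W` and
`W ∏_{p<z} (1-1/p)⁻¹ = 2 ∏_{2<p<z} (1 - 1/(p-1)²)`; pointwise, for `p > 2`,
`(1 - 1/p)(1 - 1/(p-1)²) = 1 - 1/(p-1)` and `(1 - 1/(p-1)) · (p-1)/(p-2) = 1`).
[cite: Nathanson1996, Thm 10.3 (proof)] -/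
theorem sieveProduct_eq_mul {N : ℕ} {z : ℝ} (hN : Even N) (hN0 : N ≠ 0) (hz : 2 < z) :
    sieveProduct N z =
      2 * (∏ p ∈ Nat.primesBelow ⌈z⌉₊, (1 - (p : ℝ)⁻¹)) *
        (∏ p ∈ (Nat.primesBelow ⌈z⌉₊).filter (2 < ·), (1 - 1 / ((p : ℝ) - 1) ^ 2)) *
        ∏ p ∈ (N.primeFactors.filter (2 < ·)).filter (· < ⌈z⌉₊),
          ((p : ℝ) - 1) / ((p : ℝ) - 2) := by
  unfold sieveProduct
  set Z := ⌈z⌉₊ with hZ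
  set P := Nat.primesBelow Z with hP
  have h2N : 2 ∣ N := even_iff_two_dvd.mp hN
  have h2Z : 2 < Z := Nat.lt_ceil.mpr (by exact_mod_cast hz)
  have h2P : 2 ∈ P := Nat.mem_primesBelow.mpr ⟨h2Z, Nat.prime_two⟩
  -- facts about odd primes
  have hodd : ∀ p ∈ P.filter (2 < ·), (3 : ℝ) ≤ p := fun p hp => by
    exact_mod_cast (Finset.mem_filter.mp hp).2
  -- (i) the condition `p ∤ N` forces `p > 2`
  have hi : P.filter (fun p : ℕ => ¬p ∣ N) = (P.filter (2 < ·)).filter (fun p : ℕ => ¬p ∣ N) := by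
    ext p
    simp only [Finset.mem_filter, hP, Nat.mem_primesBelow]
    constructor
    · rintro ⟨⟨hpZ, hp⟩, hpN⟩
      refine ⟨⟨⟨hpZ, hp⟩, lt_of_le_of_ne hp.two_le ?_⟩, hpN⟩
      rintro rfl
      exact hpN h2N
    · rintro ⟨⟨hpP, -⟩, hpN⟩
      exact ⟨hpP, hpN⟩
  -- (ii) `W = V · ∏_{p ∣ N} (1 - 1/(p-1))` over the odd primes below `z`
  have hii : ∏ p ∈ P.filter (2 < ·), (1 - 1 / ((p : ℝ) - 1)) =
      (∏ p ∈ (P.filter (2 < ·)).filter (fun p : ℕ => p ∣ N), (1 - 1 / ((p : ℝ) - 1))) *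
        ∏ p ∈ (P.filter (2 < ·)).filter (fun p : ℕ => ¬p ∣ N), (1 - 1 / ((p : ℝ) - 1)) :=
    (Finset.prod_filter_mul_prod_filter_not _ _ _).symm
  -- (iii) `(1 - 1/(p-1)) · (p-1)/(p-2) = 1`
  have hiii : (∏ p ∈ (P.filter (2 < ·)).filter (fun p : ℕ => p ∣ N), (1 - 1 / ((p : ℝ) - 1))) *
      ∏ p ∈ (P.filter (2 < ·)).filter (fun p : ℕ => p ∣ N), ((p : ℝ) - 1) / ((p : ℝ) - 2) = 1 := by
    rw [← Finset.prod_mul_distrib]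
    refine Finset.prod_eq_one fun p hp => ?_
    have hp3 : (3 : ℝ) ≤ p := hodd p (Finset.mem_filter.mp hp).1
    have h1 : (p : ℝ) - 1 ≠ 0 := (by linarith : (0 : ℝ) < p - 1).ne'
    have h2 : (p : ℝ) - 2 ≠ 0 := (by linarith : (0 : ℝ) < p - 2).ne'
    field_simp
    ring
  -- (iv) the odd primes `p < z` dividing `N` are the prime factors `2 < p < Z` of `N`
  have hiv : (P.filter (2 < ·)).filter (fun p : ℕ => p ∣ N) =
      (N.primeFactors.filter (2 < ·)).filter (· < Z) := by
    ext p
    simp only [Finset.mem_filter, hP, Nat.mem_primesBelow, Nat.mem_primeFactors]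
    constructor
    · rintro ⟨⟨⟨hpZ, hp⟩, h2p⟩, hpN⟩
      exact ⟨⟨⟨hp, hpN, hN0⟩, h2p⟩, hpZ⟩
    · rintro ⟨⟨⟨hp, hpN, -⟩, h2p⟩, hpZ⟩
      exact ⟨⟨⟨hpZ, hp⟩, h2p⟩, hpN⟩
  -- (v) split off the prime `2` from `U`
  have hv : ∏ p ∈ P, (1 - (p : ℝ)⁻¹) = 2⁻¹ * ∏ p ∈ P.filter (2 < ·), (1 - (p : ℝ)⁻¹) := by
    have herase : P.erase 2 = P.filter (2 < ·) := by
      ext p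
      simp only [Finset.mem_erase, Finset.mem_filter, hP, Nat.mem_primesBelow]
      constructor
      · rintro ⟨hp2, hpZ, hp⟩
        exact ⟨⟨hpZ, hp⟩, lt_of_le_of_ne hp.two_le (Ne.symm hp2)⟩
      · rintro ⟨⟨hpZ, hp⟩, h2p⟩
        exact ⟨by omega, hpZ, hp⟩
    rw [← Finset.mul_prod_erase P _ h2P, herase]
    norm_num
  -- (vi) `(1 - 1/p)(1 - 1/(p-1)²) = 1 - 1/(p-1)` for `p > 2`
  have hvi : ∏ p ∈ P.filter (2 < ·), (1 - 1 / ((p : ℝ) - 1)) =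
      (∏ p ∈ P.filter (2 < ·), (1 - (p : ℝ)⁻¹)) *
        ∏ p ∈ P.filter (2 < ·), (1 - 1 / ((p : ℝ) - 1) ^ 2) := by
    rw [← Finset.prod_mul_distrib]
    refine Finset.prod_congr rfl fun p hp => ?_
    have hp3 : (3 : ℝ) ≤ p := hodd p hp
    have h0 : (p : ℝ) ≠ 0 := by positivity
    have h1 : (p : ℝ) - 1 ≠ 0 := (by linarith : (0 : ℝ) < p - 1).ne'
    field_simp
    ring
  -- assemble
  rw [← hiv, hv, hi]
  calc ∏ p ∈ (P.filter (2 < ·)).filter (fun p : ℕ => ¬p ∣ N), (1 - 1 / ((p : ℝ) - 1))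
      = (∏ p ∈ (P.filter (2 < ·)).filter (fun p : ℕ => ¬p ∣ N), (1 - 1 / ((p : ℝ) - 1))) *
          ((∏ p ∈ (P.filter (2 < ·)).filter (fun p : ℕ => p ∣ N), (1 - 1 / ((p : ℝ) - 1))) *
            ∏ p ∈ (P.filter (2 < ·)).filter (fun p : ℕ => p ∣ N),
              ((p : ℝ) - 1) / ((p : ℝ) - 2)) := by rw [hiii, mul_one]
    _ = (∏ p ∈ P.filter (2 < ·), (1 - 1 / ((p : ℝ) - 1))) *
          ∏ p ∈ (P.filter (2 < ·)).filter (fun p : ℕ => p ∣ N), ((p : ℝ) - 1) / ((p : ℝ) - 2) := by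
        rw [hii]; ring
    _ = _ := by rw [hvi]; ring

/-- `𝔖(N) = C₂ · Q_z · R`: the local factors of `𝔖(N)` split at `Z` into those of the primes
`p < Z` and those of the primes `p ≥ Z`. [cite: Nathanson1996, (10.2)] -/
theorem singularSeries_eq_mul (N Z : ℕ) :
    singularSeries N = twinPrimeConst *
      ((∏ p ∈ (N.primeFactors.filter (2 < ·)).filter (· < Z), ((p : ℝ) - 1) / ((p : ℝ) - 2)) *
        ∏ p ∈ (N.primeFactors.filter (2 < ·)).filter (fun p : ℕ => ¬p < Z),
          ((p : ℝ) - 1) / ((p : ℝ) - 2)) := by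
  rw [singularSeries, Finset.prod_filter_mul_prod_filter_not]

/-! ### The prime factors `p ≥ z` of `N ≤ z⁸` -/

/-- If `S` is a set of prime factors of `N ≠ 0`, all `≥ z > 1`, and `N ≤ z⁸`, then `#S ≤ 8`
(`z^{#S} ≤ ∏_{p ∈ S} p ≤ N ≤ z⁸` since `∏_{p∈S} p ∣ N`). For `z = N^{1/8}`: an integer has at most
`8` prime factors `p ≥ N^{1/8}` (the book uses the cruder `ω(N) < log N` at this point).
[cite: Nathanson1996, Thm 10.3 (proof)] -/
theorem card_le_eight_of_prod_dvd {N : ℕ} {z : ℝ} (hN0 : N ≠ 0) (hz1 : 1 < z)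
    (hNz : (N : ℝ) ≤ z ^ 8) {S : Finset ℕ} (hS : S ⊆ N.primeFactors) (hSz : ∀ p ∈ S, z ≤ p) :
    S.card ≤ 8 := by
  have hdvd : (∏ p ∈ S, p) ∣ N :=
    (Finset.prod_dvd_prod_of_subset S N.primeFactors (fun p => p) hS).trans
      (Nat.prod_primeFactors_dvd N)
  have hle : (∏ p ∈ S, p) ≤ N := Nat.le_of_dvd (Nat.pos_of_ne_zero hN0) hdvd
  have h : z ^ S.card ≤ z ^ 8 := by
    calc z ^ S.card = ∏ _p ∈ S, z := (Finset.prod_const z).symm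
      _ ≤ ∏ p ∈ S, (p : ℝ) := Finset.prod_le_prod (fun _ _ => by linarith) hSz
      _ = ((∏ p ∈ S, p : ℕ) : ℝ) := (Nat.cast_prod _ _).symm
      _ ≤ N := by exact_mod_cast hle
      _ ≤ z ^ 8 := hNz
  exact (pow_le_pow_iff_right₀ hz1).mp h

/-- The factor `R = ∏_{p ∣ N, p ≥ z, p > 2} (p-1)/(p-2)` satisfies `1 ≤ R ≤ (1 + 1/(z-2))⁸` when
`N ≠ 0`, `z > 2` and `N ≤ z⁸`. [cite: Nathanson1996, Thm 10.3 (proof)] -/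
theorem one_le_largeFactor_and_le {N : ℕ} {z : ℝ} (hN0 : N ≠ 0) (hz : 2 < z)
    (hNz : (N : ℝ) ≤ z ^ 8) :
    1 ≤ ∏ p ∈ (N.primeFactors.filter (2 < ·)).filter (fun p : ℕ => ¬p < ⌈z⌉₊),
        ((p : ℝ) - 1) / ((p : ℝ) - 2) ∧
      ∏ p ∈ (N.primeFactors.filter (2 < ·)).filter (fun p : ℕ => ¬p < ⌈z⌉₊),
        ((p : ℝ) - 1) / ((p : ℝ) - 2) ≤ (1 + 1 / (z - 2)) ^ 8 := by
  set S := (N.primeFactors.filter (2 < ·)).filter (fun p : ℕ => ¬p < ⌈z⌉₊) with hSdef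
  have hSz : ∀ p ∈ S, z ≤ p := fun p hp => by
    have h : ⌈z⌉₊ ≤ p := not_lt.mp (Finset.mem_filter.mp hp).2
    exact (Nat.le_ceil z).trans (by exact_mod_cast h)
  have hS2 : ∀ p ∈ S, 2 < p := fun p hp => (Finset.mem_filter.mp (Finset.mem_filter.mp hp).1).2
  have hS : S ⊆ N.primeFactors := fun p hp => (Finset.mem_filter.mp (Finset.mem_filter.mp hp).1).1
  have hcard : S.card ≤ 8 := card_le_eight_of_prod_dvd hN0 (by linarith) hNz hS hSz
  refine ⟨Finset.one_le_prod fun p hp => one_le_singularSeriesFactor (hS2 p hp), ?_⟩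
  have hfac : ∀ p ∈ S, ((p : ℝ) - 1) / ((p : ℝ) - 2) ≤ 1 + 1 / (z - 2) := fun p hp => by
    have hzp := hSz p hp
    have hp2 : (0 : ℝ) < (p : ℝ) - 2 := by linarith
    have e : ((p : ℝ) - 1) / ((p : ℝ) - 2) = 1 + 1 / ((p : ℝ) - 2) := by
      field_simp
      ring
    rw [e]
    gcongr 1 + ?_
    exact one_div_le_one_div_of_le (by linarith) (by linarith)
  calc ∏ p ∈ S, ((p : ℝ) - 1) / ((p : ℝ) - 2) ≤ ∏ _p ∈ S, (1 + 1 / (z - 2)) :=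
        Finset.prod_le_prod (fun p hp => zero_le_one.trans (one_le_singularSeriesFactor (hS2 p hp)))
          hfac
    _ = (1 + 1 / (z - 2)) ^ S.card := Finset.prod_const _
    _ ≤ (1 + 1 / (z - 2)) ^ 8 := by
        refine pow_le_pow_right₀ ?_ hcard
        have : 0 ≤ 1 / (z - 2) := by
          have : 0 < z - 2 := by linarith
          positivity
        linarith

/-! ### Bookkeeping of the relative errors -/

/-- If `V R = M α β` with `M > 0`, `|α - 1| ≤ 50/L`, `1 ≤ β ≤ 1 + 1/L`, `1 ≤ R ≤ 1 + 16/L` and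
`L ≥ 50`, then `|V - M| ≤ 117 M/L` (`V - M = M(αβ - R)/R`, `αβ - R = (α-1)β + (β-1) - (R-1)`).
[folklore] -/
theorem abs_sub_le_of_relErrors {V M α β R L : ℝ} (hM : 0 < M) (hL : 50 ≤ L)
    (hVR : V * R = M * α * β) (hα : |α - 1| ≤ 50 / L) (hβ1 : 1 ≤ β) (hβ2 : β - 1 ≤ 1 / L)
    (hR1 : 1 ≤ R) (hR2 : R - 1 ≤ 16 / L) : |V - M| ≤ 117 * M / L := by
  have hL0 : 0 < L := by linarith
  have hR0 : 0 < R := by linarith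
  have hb : 0 ≤ β - 1 := by linarith
  have hβle : β ≤ 2 := by
    have : 1 / L ≤ 1 := by rw [div_le_one hL0]; linarith
    linarith
  have h1 : |α * β - R| ≤ 117 / L := by
    have e : α * β - R = (α - 1) * β + (β - 1) - (R - 1) := by ring
    rw [e]
    calc |(α - 1) * β + (β - 1) - (R - 1)|
        ≤ |(α - 1) * β + (β - 1)| + |R - 1| := abs_sub _ _
      _ ≤ |(α - 1) * β| + |β - 1| + |R - 1| := by gcongr; exact abs_add_le _ _
      _ = |α - 1| * β + (β - 1) + (R - 1) := by
          rw [abs_mul, abs_of_pos (by linarith : (0 : ℝ) < β), abs_of_nonneg hb,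
            abs_of_nonneg (by linarith : (0 : ℝ) ≤ R - 1)]
      _ ≤ 50 / L * 2 + 1 / L + 16 / L := by
          have hαβ : |α - 1| * β ≤ 50 / L * 2 := mul_le_mul hα hβle (by linarith) (by positivity)
          linarith
      _ = 117 / L := by ring
  have e2 : V - M = M * (α * β - R) / R := by
    rw [eq_div_iff hR0.ne']
    linear_combination hVR
  rw [e2, abs_div, abs_mul, abs_of_pos hM, abs_of_pos hR0]
  calc M * |α * β - R| / R ≤ M * |α * β - R| := div_le_self (by positivity) hR1
    _ ≤ M * (117 / L) := by gcongr
    _ = 117 * M / L := by ring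

/-! ### The theorem -/

/-- **Discharge of `chen_sieveProduct_estimate`** (Nathanson Thm 10.3, corrected by the factor `2`):
for all even `N` with `log N ≥ 400` and `z = N^{1/8}`,
`|V(z) - 2 𝔖(N) e^{-γ}/log z| ≤ 936 · (2 𝔖(N) e^{-γ}/log z)/log N`.
Inputs: Mertens' product theorem with rate (Hardy–Wright Thm 429, via
`Literature.NumberTheory.Sieve.PairProducts.abs_log_mertensProd_sub_le`), the convergence of the partial
products of `C₂` (`Literature.NumberTheory.Sieve.tendsto_twinPrimeConstPartial_holds`) with the
telescoping tail bound, and the count `#{p ∣ N : p ≥ N^{1/8}} ≤ 8`. [cite: Nathanson1996, Thm 10.3] -/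
theorem chen_sieveProduct_estimate_holds : chen_sieveProduct_estimate := by
  -- `N₀`: `log N ≥ 400`
  have hlog : Tendsto (fun N : ℕ => Real.log N) atTop atTop :=
    Real.tendsto_log_atTop.comp (tendsto_natCast_atTop_atTop (R := ℝ))
  obtain ⟨N₀, hN₀⟩ := eventually_atTop.mp (hlog.eventually_ge_atTop 400)
  refine ⟨936, N₀, fun N hN hEven => ?_⟩
  have hlogN : 400 ≤ Real.log N := hN₀ N hN
  have hNpos : (0 : ℝ) < N := by
    by_contra h
    have h0 : (N : ℝ) = 0 := le_antisymm (not_lt.mp h) N.cast_nonneg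
    rw [h0, Real.log_zero] at hlogN
    linarith
  have hN0 : N ≠ 0 := by exact_mod_cast hNpos.ne'
  -- the parameter `z = N^{1/8}` and `L = log z = (log N)/8`
  set L := Real.log (z N) with hLdef
  have hLN : L = Real.log N / 8 := by rw [hLdef, z, Real.log_rpow hNpos]; ring
  have hL50 : 50 ≤ L := by rw [hLN]; linarith
  have hL0 : 0 < L := by linarith
  have hzpos : 0 < z N := Real.rpow_pos_of_pos hNpos _
  have hzL : L + 2 ≤ z N := by
    rw [← Real.exp_log hzpos]
    have := Real.quadratic_le_exp_of_nonneg hL0.le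
    nlinarith
  have hz2 : 2 < z N := by linarith
  have hz8 : (N : ℝ) ≤ z N ^ 8 := by
    rw [z, ← Real.rpow_natCast, ← Real.rpow_mul hNpos.le]
    norm_num
  -- the pieces
  set Z := ⌈z N⌉₊ with hZ
  set U := ∏ p ∈ Nat.primesBelow Z, (1 - (p : ℝ)⁻¹) with hU
  set T := ∏ p ∈ (Nat.primesBelow Z).filter (2 < ·), (1 - 1 / ((p : ℝ) - 1) ^ 2) with hT
  set Qz := ∏ p ∈ (N.primeFactors.filter (2 < ·)).filter (· < Z),
    ((p : ℝ) - 1) / ((p : ℝ) - 2) with hQz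
  set R := ∏ p ∈ (N.primeFactors.filter (2 < ·)).filter (fun p : ℕ => ¬p < Z),
    ((p : ℝ) - 1) / ((p : ℝ) - 2) with hR
  have hV : sieveProduct N (z N) = 2 * U * T * Qz := sieveProduct_eq_mul hEven hN0 hz2
  have hS : singularSeries N = twinPrimeConst * (Qz * R) := singularSeries_eq_mul N Z
  -- `α = U e^γ L`
  have hα : |U * (Real.exp Real.eulerMascheroniConstant * L) - 1| ≤ 50 / L :=
    abs_mertensFactor_sub_one_le hz2.le (by linarith)
  -- `β = T/C₂`
  have hC2 : 0 < twinPrimeConst := twinPrimeConst_pos_holds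
  have hZz : z N ≤ Z := Nat.le_ceil _
  have h3Z : 3 ≤ Z := by
    have : (3 : ℝ) ≤ Z := by linarith
    exact_mod_cast this
  have hTdef : T = twinPrimeConstPartial (Z - 1) := by
    rw [hT, twinPrimeConstPartial, Nat.primesBelow_eq_primesLE_sub_one]
  have hC2T : twinPrimeConst ≤ T := hTdef ▸ twinPrimeConst_le_twinPrimeConstPartial _
  have hx : (((Z - 1 : ℕ) : ℝ)) = (Z : ℝ) - 1 := by
    rw [Nat.cast_sub (by omega)]; norm_num
  have hTC2 : T * (((Z : ℝ) - 1 - 1) / ((Z : ℝ) - 1)) ≤ twinPrimeConst := by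
    have h := twinPrimeConstPartial_mul_le_twinPrimeConst (x := Z - 1) (by omega)
    rwa [← hTdef, hx] at h
  have hβ1 : 1 ≤ T / twinPrimeConst := (one_le_div hC2).mpr hC2T
  have hβ2 : T / twinPrimeConst - 1 ≤ 1 / L := by
    have hZ2 : L ≤ (Z : ℝ) - 2 := by linarith
    have hZ2pos : 0 < (Z : ℝ) - 2 := by linarith
    -- from `T (Z-2)/(Z-1) ≤ C₂`: `(T - C₂)(Z - 2) ≤ C₂`, so `T/C₂ - 1 ≤ 1/(Z-2) ≤ 1/L`
    have h1 : T * ((Z : ℝ) - 2) ≤ twinPrimeConst * ((Z : ℝ) - 1) := by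
      have h := hTC2
      rw [show (Z : ℝ) - 1 - 1 = (Z : ℝ) - 2 by ring, mul_div_assoc', div_le_iff₀ (by linarith)]
        at h
      exact h
    calc T / twinPrimeConst - 1 = (T - twinPrimeConst) / twinPrimeConst := by field_simp
      _ ≤ 1 / ((Z : ℝ) - 2) := by
          rw [div_le_div_iff₀ hC2 hZ2pos]
          nlinarith
      _ ≤ 1 / L := one_div_le_one_div_of_le hL0 hZ2
  -- `R`
  obtain ⟨hR1, hRle⟩ := one_le_largeFactor_and_le hN0 hz2 hz8
  have hR2 : R - 1 ≤ 16 / L := by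
    set t := 1 / (z N - 2) with ht
    have ht0 : 0 ≤ t := by
      have : 0 < z N - 2 := by linarith
      positivity
    have htL : t ≤ 1 / L := one_div_le_one_div_of_le hL0 (by linarith)
    have ht8 : |8 * t| ≤ 1 := by
      rw [abs_of_nonneg (by positivity)]
      have : 1 / L ≤ 1 / 50 := one_div_le_one_div_of_le (by norm_num) hL50
      linarith
    have hexp : (1 + t) ^ 8 ≤ Real.exp (8 * t) := by
      have h1 : 1 + t ≤ Real.exp t := by linarith [Real.add_one_le_exp t]
      calc (1 + t) ^ 8 ≤ Real.exp t ^ 8 := pow_le_pow_left₀ (by linarith) h1 8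
        _ = Real.exp (8 * t) := by rw [← Real.exp_nat_mul]; norm_num
    have hexp1 : Real.exp (8 * t) - 1 ≤ 16 * t := by
      have h := Real.abs_exp_sub_one_le ht8
      rw [abs_of_nonneg (by positivity : (0 : ℝ) ≤ 8 * t)] at h
      linarith [le_abs_self (Real.exp (8 * t) - 1)]
    calc R - 1 ≤ (1 + t) ^ 8 - 1 := by linarith
      _ ≤ 16 * t := by linarith
      _ ≤ 16 * (1 / L) := by gcongr
      _ = 16 / L := by ring
  -- the identity `V R = M α β`
  set M := 2 * singularSeries N * Real.exp (-Real.eulerMascheroniConstant) / L with hM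
  have hMpos : 0 < M := by
    have := singularSeries_pos N
    positivity
  have hVR : sieveProduct N (z N) * R =
      M * (U * (Real.exp Real.eulerMascheroniConstant * L)) * (T / twinPrimeConst) := by
    rw [hV, hM, hS, Real.exp_neg]
    field_simp
  have hmain := abs_sub_le_of_relErrors hMpos hL50 hVR hα hβ1 hβ2 hR1 hR2
  -- `117 M / L = 936 M / log N`
  calc |sieveProduct N (z N) - M| ≤ 117 * M / L := hmain
    _ = 936 * M / Real.log N := by
        rw [show Real.log N = 8 * L by rw [hLN]; ring]
        field_simp
        norm_num

end Literature.NumberTheory.Sieve.Chen
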